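import Literature.Analysis.FluidPDE.KernelIntegralSmooth
import Summits.QuantumFields.BalabanUV.Beta.FP.BoxAverageGermLocal

/-!
# `BalabanUV.Beta.FP.BoxAverageGermHomogeneous` — road «FP» for binder row D1, N7 PLAN v1 §3, row «N7/GERM-x» of `LEAVES-FP.md`, SUPPLEMENT 2:
# THE ROW'S LITERAL FORM — `f` SMOOTH OFF THE ORIGIN, HOMOGENEOUS OF DEGREE `−2−j`, HARMONIC off the ball of radius 2 ⟹
# `∃ C ≥ 0, ∀ z, 3 ≤ ‖z‖ → |∫_{box}∫_{box} f (z + u − v) − f z| ≤ C / ‖z‖^(6+j)`, with `C = ((3/2)^(6+j)/24) · sup_{‖w‖=1} ‖D⁴f w‖`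
# (β sub-cell; CROSS-LANE supplier seat `b2b-balaban-gan24-formalise-leaf-04` (G-an2-4 formalisation swarm, gen 36); parts: `FP/BoxAverageMoments`
# p226497, `FP/BoxAverageGerm` p226750, `FP/BoxAverageGermLocal` p227230)

NOT IN PRINT AS SUCH; OUR BOOKKEEPING.  HONEST FRAMING (cell charter, verbatim): «discharging `BetaPertH` makes Bałaban's UV stability UNCONDITIONAL —
a real constructive-QFT result; it is NOT the continuum limit and NOT the Clay problem.»  HONEST DEPENDENCY (verbatim): «continuum YM on T⁴ ⇐ BetaPertH ∧
nine spine estimates (0/9 proved); BetaPertH ⇐ (D1) ∧ (D4) ∧ CAP+tail; G-an2-4 gates asym, D1 and NE2/3/4.»  ABSOLUTE RULE (cell, verbatim): «No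
internally-minted statement may enter as a cited fact. Every hypothesis is either kernel-proved in this package or a verbatim quotation of a PUBLISHED
theorem with page reference.»  Nothing is cited; no `def`; no `def … : Prop`; composition of part 3 with the tree's [folklore]
`Literature.Analysis.FluidPDE.exists_norm_iteratedFDeriv_le_of_homogeneous` («derivatives of a homogeneous function smooth off the origin:
`‖DᵐΦ z‖ ≤ C(m)·‖z‖^{d−m}`»); NO road input; discharges NOTHING of N7 ∕ `hasym` ∕ D1 (the perfect propagator's box-average representation, its Lorentz
tensor and HARMONICITY of its components are the OWNER's §3 inputs, not asserted here); NOT `BetaPertH`, NOT continuum, NOT Clay.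

* [folklore] `decay_of_homogeneous` — homogeneous of degree `−(2+j)` and `C^∞` off `0` ⟹ `∃ C₄ ≥ 0, ∀ x ≠ 0, ‖D⁴f x‖ ≤ C₄ / ‖x‖^(6+j)`.
* [our object] **`exists_abs_boxAvg_sub_le_of_homogeneous`** — the row: homogeneous of degree `−(2+j)`, `C^∞` off `0`, `Σ_i D²f(x)(e_i,e_i) = 0` for
  `2 ≤ ‖x‖` ⟹ `∃ C ≥ 0, ∀ z, 3 ≤ ‖z‖ → |∫_{box}∫_{box} f (z + u − v) − f z| ≤ C / ‖z‖^(6+j)`.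
Provenance: unit `b2b-balaban-gan24-formalise-leaf-04` (gen 36), 2026-08-20; no existing file touched.  0 sorry.
-/

noncomputable section

open Set MeasureTheory
open scoped ContDiff
open Summit.QuantumFields.BalabanUV.Beta.FP.BoxAverageMoments
open Summit.QuantumFields.BalabanUV.Beta.FP.BoxAverageGermLocal

namespace Summit.QuantumFields.BalabanUV.Beta.FP.BoxAverageGermHomogeneous

variable {ι : Type*} [Fintype ι]

/-- [folklore] **FOURTH-DERIVATIVE DECAY OF A HOMOGENEOUS KERNEL**: `f (c • x) = c^{−(2+j)} f x` (`c > 0`) and `f ∈ C^∞({0}ᶜ)` ⟹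
`∃ C₄ ≥ 0, ∀ x ≠ 0, ‖D⁴f x‖ ≤ C₄ / ‖x‖^(6+j)` (the tree's `exists_norm_iteratedFDeriv_le_of_homogeneous` at `m = 4`, exponent bookkeeping
`(−(2+j)) − 4 = −(6+j)`). -/
theorem decay_of_homogeneous {f : (ι → ℝ) → ℝ} {j : ℕ}
    (hhom : ∀ c : ℝ, 0 < c → ∀ x : ι → ℝ, f (c • x) = c ^ (-(2 + (j : ℤ))) • f x) (hs : ContDiffOn ℝ ∞ f {0}ᶜ) :
    ∃ C₄ : ℝ, 0 ≤ C₄ ∧ ∀ x : ι → ℝ, x ≠ 0 → ‖iteratedFDeriv ℝ 4 f x‖ ≤ C₄ / ‖x‖ ^ (6 + j) := by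
  obtain ⟨C, hC, hb⟩ := Literature.Analysis.FluidPDE.exists_norm_iteratedFDeriv_le_of_homogeneous f (-(2 + (j : ℤ))) hhom hs 4
  refine ⟨C, hC, fun x hx => ?_⟩
  have h := hb x hx
  have hxpos : 0 < ‖x‖ := norm_pos_iff.2 hx
  have e : ‖x‖ ^ (-(2 + (j : ℤ)) - ((4 : ℕ) : ℤ)) = (‖x‖ ^ (6 + j))⁻¹ := by
    rw [show (-(2 + (j : ℤ)) - ((4 : ℕ) : ℤ) : ℤ) = -((6 + j : ℕ) : ℤ) by push_cast; ring, zpow_neg, zpow_natCast]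
  rw [e, ← div_eq_mul_inv] at h
  exact h

variable [DecidableEq ι]

/-- **THE BOX-AVERAGE GERM LEMMA, THE ROW'S LITERAL FORM.**  For `f : (ι → ℝ) → ℝ` smooth off the origin, homogeneous of degree `−(2+j)`, and
harmonic in the sense `Σ_i D²f(x)(e_i, e_i) = 0` for `2 ≤ ‖x‖`:
`∃ C ≥ 0, ∀ z, 3 ≤ ‖z‖ → |∫_{box} ∫_{box} f (z + u − v) − f z| ≤ C / ‖z‖^(6+j)` (sup norm on `ι → ℝ`; `C = ((3/2)^(6+j)/24)·C₄`). [our object] -/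
theorem exists_abs_boxAvg_sub_le_of_homogeneous {f : (ι → ℝ) → ℝ} {j : ℕ}
    (hhom : ∀ c : ℝ, 0 < c → ∀ x : ι → ℝ, f (c • x) = c ^ (-(2 + (j : ℤ))) • f x) (hs : ContDiffOn ℝ ∞ f {0}ᶜ)
    (hΔ : ∀ x : ι → ℝ, 2 ≤ ‖x‖ → ∑ i, iteratedFDeriv ℝ 2 f x (fun _ => (Pi.single i (1 : ℝ) : ι → ℝ)) = 0) :
    ∃ C : ℝ, 0 ≤ C ∧ ∀ z : ι → ℝ, 3 ≤ ‖z‖ →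
      |(∫ u in box ι, ∫ v in box ι, f (z + u - v)) - f z| ≤ C / ‖z‖ ^ (6 + j) := by
  obtain ⟨C₄, hC₄, hD4⟩ := decay_of_homogeneous hhom hs
  have hf : ContDiffOn ℝ 4 f {x : ι → ℝ | 1 < ‖x‖} := by
    refine (hs.of_le (WithTop.coe_le_coe.2 le_top)).mono fun x hx => ?_
    have hx' : (1 : ℝ) < ‖x‖ := hx
    intro h0
    rw [mem_singleton_iff] at h0
    rw [h0, norm_zero] at hx'
    exact absurd hx' (by norm_num)
  have hD4' : ∀ x : ι → ℝ, 2 ≤ ‖x‖ → ‖iteratedFDeriv ℝ 4 f x‖ ≤ C₄ / ‖x‖ ^ (6 + j) := fun x hx =>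
    hD4 x (by intro h0; rw [h0, norm_zero] at hx; exact absurd hx (by norm_num))
  refine ⟨(3 / 2 : ℝ) ^ (6 + j) / 24 * C₄, by positivity, fun z hz => ?_⟩
  have h := abs_boxAvg_sub_le_of_decay_off_ball hf hC₄ hD4' hΔ hz
  calc |(∫ u in box ι, ∫ v in box ι, f (z + u - v)) - f z| ≤ (3 / 2 : ℝ) ^ (6 + j) / 24 * (C₄ / ‖z‖ ^ (6 + j)) := h
    _ = (3 / 2 : ℝ) ^ (6 + j) / 24 * C₄ / ‖z‖ ^ (6 + j) := by ring

end Summit.QuantumFields.BalabanUV.Beta.FP.BoxAverageGermHomogeneous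

end
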